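import Summits.ResolutionOfSingularities.ResolutionOfSingularities.Theses.Descent
import Summits.ResolutionOfSingularities.ResolutionOfSingularities.Theses.EscapeRate
import Summits.ResolutionOfSingularities.ResolutionOfSingularities.Theses.RadicialJung
import Summits.ResolutionOfSingularities.ResolutionOfSingularities.Theses.PAlteration
import Summits.ResolutionOfSingularities.ResolutionOfSingularities.Theorems.DescentDescentPerfectToAllOfCleanModels
import Summits.ResolutionOfSingularities.ResolutionOfSingularities.Theorems.RadicialJungCleanResolvesProof
import Summits.ResolutionOfSingularities.ResolutionOfSingularities.Theorems.PAlterationPicoverDegPDimLeThree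
import Summits.ResolutionOfSingularities.ResolutionOfSingularities.Theorems.DescentDescentPerfectToAllDimOne
import HarnessLib

/-!
# Crux `DescentPerfectToAll` (stmt-ResolutionOfSingularities-0549), line `via-clean-models` — support glue G1:
# the DIMENSION-GRADED chain `CleanModels_{dim ≥ 4} ⟹ Picover ⟹ DescentPerfectToAll` modulo `CossartPiltant2019`

Line card `Cruxes/DescentPerfectToAll/Lines/via-clean-models.md` (rev 2c), item G1 («support glue, M: land the
dimension-graded chain … then `stub_cleanModelsDimThree` is replaced by the named fact `CossartPiltant2019` for
rung B and the register reads "rung B = F-75c-free, = CleanModels_{≥4} modulo CP 2019"»), promoted to the FIRST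
support task by the critic (res-B-crit-1, sharpening s1, 2026-08-28).

The point: no re-threading of the one-root chain (`descentPerfectToAll_of_picover`) by dimension is needed.  The
chain `CleanModels ⟹ Picover` (`Theorems.picover_of_cleanModels`, p536972) factors through the DEGREE-`p` RESIDUE
`DegP_p` («the normalisation `W^L` of a regular integral separated finite-type `k`-scheme `W` in a degree-`p` purely
inseparable extension `L/K(W)` has a resolution»), and `DegP_p` is already dimension-graded in the tree:
* `dim W ≤ 3`: `Picover.DegPDimLeThree.picoverDegP_of_dim_le_three (hCP : CossartPiltant2019)`
  (`PAlterationPicoverDegPDimLeThree.lean`: `W^L → W` is a finite alteration, so `dim W^L = dim W ≤ 3`, and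
  Cossart–Piltant resolves `W^L`);
* `dim W ≥ 4`: a pointwise log-clean regular model from `CleanModels` restricted to `¬ dim W ≤ 3` resolves `W^L`
  by the PROVED item `RadicialJung.CleanResolves` (`Theorems.cleanResolves_proof`, stmt-16286: exceptionalisation
  game + Kato 1994 (10.4)).
Then `RadicialJung.CleanModelsSuffice.picoverAt_of_degPAt` (Temkin's degree-`p` tower) gives `Picover` at `p`, and
`descentPerfectToAll_of_picover` (p113743) the crux.

## Content (namespace `Summit.ResolutionOfSingularities.ResolutionOfSingularities.Theorems`)
* `degP_of_cleanModelsDimGEFour` — `CossartPiltant2019 →` (`CleanModels` restricted to `¬ dim W ≤ 3`) `→ DegP_p`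
  for every prime `p`, all dimensions;
* `picover_of_cleanModelsDimGEFour` — `… → PAlteration.Picover`;
* `descentPerfectToAll_of_cleanModelsDimGEFour` — `… → Descent.DescentPerfectToAll` (the item's decl), and the
  `EscapeRate` copy `escapeRate_descentPerfectToAll_of_cleanModelsDimGEFour` (the registered 0549 skeleton's decl).

Honest framing: nothing here is new mathematics and nothing here proves resolution in characteristic `p`;
`CossartPiltant2019` is an undischarged named fact of the tree and `CleanModels` in `dim W ≥ 4` (the hardest stub
`stub_cleanModelsDimGEFour` of the line, ON `Literature.Barriers.ResolutionOfSingularities.DimensionFourFrontier`)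
remains OPEN.  This file only records that rung B (`DescentPerfectToAll`) is PRICED by that one stub modulo
Cossart–Piltant: the F-75c typing debt and the dim-3 slice of `CleanModels` leave rung B's price (they stay debts of
crux stmt-15917 `RadicialJung.CleanModels`).
-/

noncomputable section

set_option linter.dupNamespace false -- mandated namespace of this single-conjunct summit

open CategoryTheory AlgebraicGeometry
open Literature.AlgebraicGeometry.Resolution

namespace Summit.ResolutionOfSingularities.ResolutionOfSingularities.Theorems

/-- **`CleanModels` in dimension `≥ 4` + Cossart–Piltant ⟹ the degree-`p` residue `DegP_p` in ALL dimensions.**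
For a prime `p`, a field `k` of characteristic `p`, a regular integral `W` separated of finite type over `k` and a
purely inseparable extension `L/K(W)` of degree `p`, the normalisation `W^L` has a resolution: if `dim W ≤ 3` by the
named fact `CossartPiltant2019` (`picoverDegP_of_dim_le_three`: `dim W^L = dim W`), else by the pointwise log-clean
regular model supplied by the hypothesis (= `RadicialJung.CleanModels` restricted to `¬ dim W ≤ 3`) and the proved
item `RadicialJung.CleanResolves` (`cleanResolves_proof`). [cite: CossartPiltant2019, Thm. 1.1] -/
theorem degP_of_cleanModelsDimGEFour (hCP : CossartPiltant2019.{0})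
    (h4 : ∀ p : ℕ, p.Prime → ∀ (k : Type) [Field k] [CharP k p] (W : AlgebraicGeometry.Scheme.{0}) [AlgebraicGeometry.IsIntegral W] (f : W ⟶ AlgebraicGeometry.Spec (.of k)) (L : Type) [Field L] [Algebra W.functionField L], AlgebraicGeometry.IsSeparated f → AlgebraicGeometry.LocallyOfFiniteType f → AlgebraicGeometry.QuasiCompact f → Literature.AlgebraicGeometry.Resolution.Scheme.IsRegular W → IsPurelyInseparable W.functionField L → Module.finrank W.functionField L = p → ¬ topologicalKrullDim W ≤ 3 → ∃ (V : AlgebraicGeometry.Scheme.{0}) (π : V ⟶ W) (_ : AlgebraicGeometry.IsIntegral V) (_ : AlgebraicGeometry.IsDominant π), AlgebraicGeometry.IsProper π ∧ Literature.AlgebraicGeometry.Resolution.IsBirational π ∧ Literature.AlgebraicGeometry.Resolution.Scheme.IsRegular V ∧ (∀ v : V, (∃ (y : L) (g : W.functionField), y ∉ Set.range (algebraMap W.functionField L) ∧ algebraMap W.functionField L g = y ^ p ∧ ((∃ (d m : ℕ) (hmd : m ≤ d) (t : Fin d → V.presheaf.stalk v) (a : Fin m → ℕ), Ideal.span (Set.range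 t) = IsLocalRing.maximalIdeal (V.presheaf.stalk v) ∧ ringKrullDim (V.presheaf.stalk v) = (d : WithBot ℕ∞) ∧ 0 < m ∧ (∀ i, ¬ p ∣ a i) ∧ Literature.AlgebraicGeometry.Motives.RatFn.functionFieldMap π g = ∏ i : Fin m, (algebraMap (V.presheaf.stalk v) V.functionField (t (Fin.castLE hmd i))) ^ (a i)) ∨ (∃ u₀ : V.presheaf.stalk v, IsUnit u₀ ∧ Literature.AlgebraicGeometry.Motives.RatFn.functionFieldMap π g = algebraMap (V.presheaf.stalk v) V.functionField u₀ ∧ ((∀ c : V.presheaf.stalk v, u₀ - c ^ p ∉ IsLocalRing.maximalIdeal (V.presheaf.stalk v)) ∨ (∃ c : V.presheaf.stalk v, u₀ - c ^ p ∈ IsLocalRing.maximalIdeal (V.presheaf.stalk v) ∧ u₀ - c ^ p ∉ IsLocalRing.maximalIdeal (V.presheaf.stalk v) ^ 2)))))))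
    (p : ℕ) (hp : p.Prime) :
    ∀ (k : Type) [Field k] [CharP k p] (W : Scheme.{0}) [IsIntegral W]
      (f : W ⟶ Spec (.of k)) (L : Type) [Field L] [Algebra W.functionField L],
      IsSeparated f → LocallyOfFiniteType f → QuasiCompact f → Scheme.IsRegular W →
      IsPurelyInseparable W.functionField L → Module.finrank W.functionField L = p →
      Scheme.HasResolution (normalizationIn W L) := by
  intro k _ _ W _ f L _ _ hs hl hq hr hpi hd
  by_cases hdim : topologicalKrullDim W ≤ 3
  · exact Picover.DegPDimLeThree.picoverDegP_of_dim_le_three hCP p hp k W f L hs hl hq hr hpi hd hdim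
  · obtain ⟨V, π, hVi, hdom, hV⟩ := h4 p hp k W f L hs hl hq hr hpi hd hdim
    exact cleanResolves_proof p hp k W f L hs hl hq hr hpi hd V π hV

/-- **`CleanModels` in dimension `≥ 4` + Cossart–Piltant ⟹ `Picover`** (crux stmt-0554 of route pAlteration), in
all dimensions: the degree-`p` residue of `degP_of_cleanModelsDimGEFour` fed to Temkin's degree-`p` tower
`RadicialJung.CleanModelsSuffice.picoverAt_of_degPAt`. [cite: Temkin2013, Rem. 1.3.5 (ii)] -/
theorem picover_of_cleanModelsDimGEFour (hCP : CossartPiltant2019.{0})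
    (h4 : ∀ p : ℕ, p.Prime → ∀ (k : Type) [Field k] [CharP k p] (W : AlgebraicGeometry.Scheme.{0}) [AlgebraicGeometry.IsIntegral W] (f : W ⟶ AlgebraicGeometry.Spec (.of k)) (L : Type) [Field L] [Algebra W.functionField L], AlgebraicGeometry.IsSeparated f → AlgebraicGeometry.LocallyOfFiniteType f → AlgebraicGeometry.QuasiCompact f → Literature.AlgebraicGeometry.Resolution.Scheme.IsRegular W → IsPurelyInseparable W.functionField L → Module.finrank W.functionField L = p → ¬ topologicalKrullDim W ≤ 3 → ∃ (V : AlgebraicGeometry.Scheme.{0}) (π : V ⟶ W) (_ : AlgebraicGeometry.IsIntegral V) (_ : AlgebraicGeometry.IsDominant π), AlgebraicGeometry.IsProper π ∧ Literature.AlgebraicGeometry.Resolution.IsBirational π ∧ Literature.AlgebraicGeometry.Resolution.Scheme.IsRegular V ∧ (∀ v : V, (∃ (y : L) (g : W.functionField), y ∉ Set.range (algebraMap W.functionField L) ∧ algebraMap W.functionField L g = y ^ p ∧ ((∃ (d m : ℕ) (hmd : m ≤ d) (t : Fin d → V.presheaf.stalk v) (a : Fin m → ℕ), Ideal.span (Set.range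 t) = IsLocalRing.maximalIdeal (V.presheaf.stalk v) ∧ ringKrullDim (V.presheaf.stalk v) = (d : WithBot ℕ∞) ∧ 0 < m ∧ (∀ i, ¬ p ∣ a i) ∧ Literature.AlgebraicGeometry.Motives.RatFn.functionFieldMap π g = ∏ i : Fin m, (algebraMap (V.presheaf.stalk v) V.functionField (t (Fin.castLE hmd i))) ^ (a i)) ∨ (∃ u₀ : V.presheaf.stalk v, IsUnit u₀ ∧ Literature.AlgebraicGeometry.Motives.RatFn.functionFieldMap π g = algebraMap (V.presheaf.stalk v) V.functionField u₀ ∧ ((∀ c : V.presheaf.stalk v, u₀ - c ^ p ∉ IsLocalRing.maximalIdeal (V.presheaf.stalk v)) ∨ (∃ c : V.presheaf.stalk v, u₀ - c ^ p ∈ IsLocalRing.maximalIdeal (V.presheaf.stalk v) ∧ u₀ - c ^ p ∉ IsLocalRing.maximalIdeal (V.presheaf.stalk v) ^ 2))))))) :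
    Summit.ResolutionOfSingularities.ResolutionOfSingularities.Theses.PAlteration.Picover := by
  intro p hp k _ _ Y X f g hsep hlft hqc hY hYreg hX hfin hui hsurj
  exact RadicialJung.CleanModelsSuffice.picoverAt_of_degPAt p hp (degP_of_cleanModelsDimGEFour hCP h4 p hp)
    k Y X f g hsep hlft hqc hY hYreg hX hfin hui hsurj

/-- **G1: `CleanModels` in dimension `≥ 4` + Cossart–Piltant ⟹ `DescentPerfectToAll`** (the item's own decl
`Theses.Descent.DescentPerfectToAll`, crux stmt-ResolutionOfSingularities-0549): `Picover` (above) and the landed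
`descentPerfectToAll_of_picover` (radicial bottom, one-root reduction, perfect closure + limit descent + radicial
tower).  Rung B is thereby priced by ONE open statement — `RadicialJung.CleanModels` restricted to `dim W ≥ 4` —
modulo the named fact `CossartPiltant2019`; it is not paid. [cite: CossartPiltant2019, Thm. 1.1] -/
theorem descentPerfectToAll_of_cleanModelsDimGEFour (hCP : CossartPiltant2019.{0})
    (h4 : ∀ p : ℕ, p.Prime → ∀ (k : Type) [Field k] [CharP k p] (W : AlgebraicGeometry.Scheme.{0}) [AlgebraicGeometry.IsIntegral W] (f : W ⟶ AlgebraicGeometry.Spec (.of k)) (L : Type) [Field L] [Algebra W.functionField L], AlgebraicGeometry.IsSeparated f → AlgebraicGeometry.LocallyOfFiniteType f → AlgebraicGeometry.QuasiCompact f → Literature.AlgebraicGeometry.Resolution.Scheme.IsRegular W → IsPurelyInseparable W.functionField L → Module.finrank W.functionField L = p → ¬ topologicalKrullDim W ≤ 3 → ∃ (V : AlgebraicGeometry.Scheme.{0}) (π : V ⟶ W) (_ : AlgebraicGeometry.IsIntegral V) (_ : AlgebraicGeometry.IsDominant π), AlgebraicGeometry.IsProper π ∧ Literature.AlgebraicGeometry.Resolution.IsBirational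 π ∧ Literature.AlgebraicGeometry.Resolution.Scheme.IsRegular V ∧ (∀ v : V, (∃ (y : L) (g : W.functionField), y ∉ Set.range (algebraMap W.functionField L) ∧ algebraMap W.functionField L g = y ^ p ∧ ((∃ (d m : ℕ) (hmd : m ≤ d) (t : Fin d → V.presheaf.stalk v) (a : Fin m → ℕ), Ideal.span (Set.range t) = IsLocalRing.maximalIdeal (V.presheaf.stalk v) ∧ ringKrullDim (V.presheaf.stalk v) = (d : WithBot ℕ∞) ∧ 0 < m ∧ (∀ i, ¬ p ∣ a i) ∧ Literature.AlgebraicGeometry.Motives.RatFn.functionFieldMap π g = ∏ i : Fin m, (algebraMap (V.presheaf.stalk v) V.functionField (t (Fin.castLE hmd i))) ^ (a i)) ∨ (∃ u₀ : V.presheaf.stalk v, IsUnit u₀ ∧ Literature.AlgebraicGeometry.Motives.RatFn.functionFieldMap π g = algebraMap (V.presheaf.stalk v) V.functionField u₀ ∧ ((∀ c : V.presheaf.stalk v, u₀ - c ^ p ∉ IsLocalRing.maximalIdeal (V.presheaf.stalk v)) ∨ (∃ c : V.presheaf.stalk v, u₀ - c ^ p ∈ IsLocalRing.maximalIdeal (V.presheaf.stalk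 v) ∧ u₀ - c ^ p ∉ IsLocalRing.maximalIdeal (V.presheaf.stalk v) ^ 2))))))) :
    Summit.ResolutionOfSingularities.ResolutionOfSingularities.Theses.Descent.DescentPerfectToAll :=
  fun p hp H => descentPerfectToAll_of_picover (picover_of_cleanModelsDimGEFour hCP h4) p hp H

/-- Same implication, concluding the `EscapeRate` copy of the crux (rfl-equal; the decl the registered 0549
skeleton `Lines/via_clean_models.lean` concludes in `DescentPerfectToAll_of`). [cite: CossartPiltant2019, Thm. 1.1] -/
theorem escapeRate_descentPerfectToAll_of_cleanModelsDimGEFour (hCP : CossartPiltant2019.{0})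
    (h4 : ∀ p : ℕ, p.Prime → ∀ (k : Type) [Field k] [CharP k p] (W : AlgebraicGeometry.Scheme.{0}) [AlgebraicGeometry.IsIntegral W] (f : W ⟶ AlgebraicGeometry.Spec (.of k)) (L : Type) [Field L] [Algebra W.functionField L], AlgebraicGeometry.IsSeparated f → AlgebraicGeometry.LocallyOfFiniteType f → AlgebraicGeometry.QuasiCompact f → Literature.AlgebraicGeometry.Resolution.Scheme.IsRegular W → IsPurelyInseparable W.functionField L → Module.finrank W.functionField L = p → ¬ topologicalKrullDim W ≤ 3 → ∃ (V : AlgebraicGeometry.Scheme.{0}) (π : V ⟶ W) (_ : AlgebraicGeometry.IsIntegral V) (_ : AlgebraicGeometry.IsDominant π), AlgebraicGeometry.IsProper π ∧ Literature.AlgebraicGeometry.Resolution.IsBirational π ∧ Literature.AlgebraicGeometry.Resolution.Scheme.IsRegular V ∧ (∀ v : V, (∃ (y : L) (g : W.functionField), y ∉ Set.range (algebraMap W.functionField L) ∧ algebraMap W.functionField L g = y ^ p ∧ ((∃ (d m : ℕ) (hmd : m ≤ d) (t : Fin d → V.presheaf.stalk v) (a : Fin m → ℕ), Ideal.span (Set.range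 t) = IsLocalRing.maximalIdeal (V.presheaf.stalk v) ∧ ringKrullDim (V.presheaf.stalk v) = (d : WithBot ℕ∞) ∧ 0 < m ∧ (∀ i, ¬ p ∣ a i) ∧ Literature.AlgebraicGeometry.Motives.RatFn.functionFieldMap π g = ∏ i : Fin m, (algebraMap (V.presheaf.stalk v) V.functionField (t (Fin.castLE hmd i))) ^ (a i)) ∨ (∃ u₀ : V.presheaf.stalk v, IsUnit u₀ ∧ Literature.AlgebraicGeometry.Motives.RatFn.functionFieldMap π g = algebraMap (V.presheaf.stalk v) V.functionField u₀ ∧ ((∀ c : V.presheaf.stalk v, u₀ - c ^ p ∉ IsLocalRing.maximalIdeal (V.presheaf.stalk v)) ∨ (∃ c : V.presheaf.stalk v, u₀ - c ^ p ∈ IsLocalRing.maximalIdeal (V.presheaf.stalk v) ∧ u₀ - c ^ p ∉ IsLocalRing.maximalIdeal (V.presheaf.stalk v) ^ 2))))))) :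
    Summit.ResolutionOfSingularities.ResolutionOfSingularities.Theses.EscapeRate.DescentPerfectToAll :=
  fun p hp H => descentPerfectToAll_of_picover (picover_of_cleanModelsDimGEFour hCP h4) p hp H

end Summit.ResolutionOfSingularities.ResolutionOfSingularities.Theorems

end
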